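import Summits.CriticalPhenomena.PercolationContinuityZ3.Theorems.PercNearOneGluingNoHeavyQuantFarSunGameSound
import Summits.CriticalPhenomena.PercolationContinuityZ3.Theorems.PercNearOneGluingNoHeavyQuantFarSunCondition
import Mathlib.Algebra.BigOperators.Ring.Finset
import Mathlib.Algebra.Order.BigOperators.Group.Finset
import Mathlib.Tactic.FieldSimp
import Mathlib.Tactic.Ring
import Mathlib.Tactic.Linarith
import Mathlib.Tactic.Positivity
import HarnessLib

/-!
# FAR beyond trees: the flank automaton computes (a lower bound of) the flank payoff — `autoE` as a pattern expectation

builds on p205010 (kernel theorem, internal audit signed; external expert review pending)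

Support file (`--supports stmt-CriticalPhenomena-4575`), seat `prim-cert-1` (gen 39); memo `prim-cert-1/FROM-prim-cert-1-g39-VERTEX-GAME.md` §3, §4 (L2).
Continues `…QuantFarSunGame`.

* `HairyCycle.flankCount K Q` (`Fl`) — the number of CLOSED positions `k < K` (`k ∉ Q`) with at least two members of `Q` below and two above;
  `HairyCycle.flankPay K Q = Fl/(#Q − 3)·𝟙[#Q ≥ 4] − 𝟙[#Q ≤ 4]` — the layer-2 flank payoff (its hair-law mean is `G_avg − 1`, separate file).
* **`HairyCycle.autoE_eq_sum_hairW`** — `autoE start (h 0, …, h (K−1)) = Σ_{Q ⊆ range K} hairW K h Q · pay (run Q)`: the automaton's mean payoff IS the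
  pattern expectation of "payoff of the state reached on the word `𝟙_Q`" (induction over an arbitrary suffix of positions, `autoE_range'`).
* **`HairyCycle.pay_run_le_flankPay`** — for `Q ⊆ range K`, `K ≤ Kcred`, `5 ≤ Amax`: `pay (run Q) ≤ flankPay K Q` (invariants of the run: `A = min(#opens, Amax)`,
  `Nc`/`Np` bounded by the closed hairs of the current/previous level, `Cf` by the closed hairs with ≥ 2 opens on each side so far; caps only lose).
* **`HairyCycle.sum_hairW_flankPay_nonneg_of_gameCert`** — hence a passed certificate gives `0 ≤ Σ_Q hairW K h Q · flankPay K Q` at every word `h` over the alphabet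
  with certified weight.
Elementary [this work]; no sorries; standard axioms.
-/

noncomputable section

namespace Summit.CriticalPhenomena.PercolationContinuityZ3.Theorems.HairyCycle

open Finset

variable {K : ℕ}

/-! ## The flank payoff of a pattern -/

/-- `Fl(Q)`: closed positions `k < K` with at least two members of `Q` strictly below and two strictly above. [this work] -/
def flankCount (K : ℕ) (Q : Finset ℕ) : ℕ :=
  ((range K).filter fun k => k ∉ Q ∧ 2 ≤ (Q.filter fun e => e < k).card ∧ 2 ≤ (Q.filter fun e => k < e).card).card

/-- The layer-2 flank payoff `Fl(Q)/(#Q − 3)·𝟙[4 ≤ #Q] − 𝟙[#Q ≤ 4]`. [this work] -/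
def flankPay (K : ℕ) (Q : Finset ℕ) : ℝ :=
  (if 4 ≤ Q.card then (flankCount K Q : ℝ) / ((Q.card : ℝ) - 3) else 0) - (if Q.card ≤ 4 then 1 else 0)

/-! ## The automaton run on a pattern and `autoE` as a pattern expectation -/

/-- Running the flank automaton over positions `m, …, m+n−1`, hair `k` open iff `k ∈ Q`. [this work] -/
def FSt.runI (Amax C Cc : ℕ) (Q : Finset ℕ) (s : FSt) (m n : ℕ) : FSt :=
  (List.range' m n).foldl (fun st k => if k ∈ Q then st.op Amax Cc else st.cl C) s

/-- Product weight of a pattern over an index set: `∏_{k ∈ S} (h k if k ∈ Q else 1 − h k)` (`hairW K h Q` is the case `S = range K`). [this work] -/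
def prodW (S : Finset ℕ) (h : ℕ → ℝ) (Q : Finset ℕ) : ℝ := ∏ k ∈ S, if k ∈ Q then h k else 1 - h k

/-- One more step of the run of the automaton along `Q`, at a member of `Q` (an open hair: `op`). [this work] -/
theorem runI_succ_mem {Amax C Cc : ℕ} {Q : Finset ℕ} (s : FSt) {m : ℕ} (n : ℕ) (hm : m ∈ Q) :
    FSt.runI Amax C Cc Q s m (n + 1) = FSt.runI Amax C Cc Q (s.op Amax Cc) (m + 1) n := by
  unfold FSt.runI
  rw [List.range'_succ, List.foldl_cons, if_pos hm]

/-- One more step of the run of the automaton along `Q`, at a non-member of `Q` (a closed hair: `cl`). [this work] -/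
theorem runI_succ_not_mem {Amax C Cc : ℕ} {Q : Finset ℕ} (s : FSt) {m : ℕ} (n : ℕ) (hm : m ∉ Q) :
    FSt.runI Amax C Cc Q s m (n + 1) = FSt.runI Amax C Cc Q (s.cl C) (m + 1) n := by
  unfold FSt.runI
  rw [List.range'_succ, List.foldl_cons, if_neg hm]

/-- The run over positions `≥ m+1` does not see whether `m` is in the pattern. [this work] -/
theorem runI_insert_of_lt {Amax C Cc : ℕ} (Q : Finset ℕ) {a : ℕ} :
    ∀ (n m : ℕ) (s : FSt), a < m → FSt.runI Amax C Cc (insert a Q) s m n = FSt.runI Amax C Cc Q s m n := by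
  intro n
  induction n with
  | zero => intro m s _; rfl
  | succ n ih =>
    intro m s ham
    have hne : m ≠ a := Nat.ne_of_gt ham
    by_cases hm : m ∈ Q
    · rw [runI_succ_mem s n (Finset.mem_insert_of_mem hm), runI_succ_mem s n hm, ih (m + 1) _ (by omega)]
    · have hm' : m ∉ insert a Q := by rw [Finset.mem_insert]; exact not_or.2 ⟨hne, hm⟩
      rw [runI_succ_not_mem s n hm', runI_succ_not_mem s n hm, ih (m + 1) _ (by omega)]

/-- The product weight over `S ∌ a` does not see whether `a` is in the pattern. [this work] -/
theorem prodW_insert_of_not_mem {S : Finset ℕ} {a : ℕ} (ha : a ∉ S) (h : ℕ → ℝ) (Q : Finset ℕ) :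
    prodW S h (insert a Q) = prodW S h Q := by
  unfold prodW
  refine Finset.prod_congr rfl fun k hk => ?_
  have hka : k ≠ a := fun e => ha (e ▸ hk)
  simp only [Finset.mem_insert, hka, false_or]

/-- **`autoE` over a block of positions is a pattern expectation** (general suffix form). [this work] -/
theorem autoE_range' (Amax C Cc Kcred : ℕ) (h : ℕ → ℝ) :
    ∀ (n m : ℕ) (s : FSt), autoE Amax C Cc Kcred s ((List.range' m n).map h) =
      ∑ Q ∈ (Finset.Ico m (m + n)).powerset, prodW (Finset.Ico m (m + n)) h Q * (FSt.runI Amax C Cc Q s m n).pay Amax Kcred := by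
  intro n
  induction n with
  | zero =>
    intro m s
    simp only [List.range'_zero, List.map_nil, Nat.add_zero, Finset.Ico_self, Finset.powerset_empty, Finset.sum_singleton]
    unfold prodW FSt.runI
    simp [autoE]
  | succ n ih =>
    intro m s
    rw [List.range'_succ, List.map_cons]
    change h m * autoE Amax C Cc Kcred (s.op Amax Cc) ((List.range' (m + 1) n).map h) +
        (1 - h m) * autoE Amax C Cc Kcred (s.cl C) ((List.range' (m + 1) n).map h) = _
    rw [ih (m + 1) (s.op Amax Cc), ih (m + 1) (s.cl C)]
    have hS : Finset.Ico m (m + (n + 1)) = insert m (Finset.Ico (m + 1) (m + 1 + n)) := by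
      rw [show m + 1 + n = m + (n + 1) by omega]
      exact (Finset.insert_Ico_add_one_left_eq_Ico (by omega)).symm
    have hmS : m ∉ Finset.Ico (m + 1) (m + 1 + n) := by simp
    rw [hS, Finset.sum_powerset_insert hmS]
    -- patterns without `m` (closed at `m`) and with `m` (open at `m`)
    have hcl : ∀ Q ∈ (Finset.Ico (m + 1) (m + 1 + n)).powerset,
        prodW (insert m (Finset.Ico (m + 1) (m + 1 + n))) h Q * (FSt.runI Amax C Cc Q s m (n + 1)).pay Amax Kcred =
          (1 - h m) * (prodW (Finset.Ico (m + 1) (m + 1 + n)) h Q * (FSt.runI Amax C Cc Q (s.cl C) (m + 1) n).pay Amax Kcred) := by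
      intro Q hQ
      rw [Finset.mem_powerset] at hQ
      have hmQ : m ∉ Q := fun hm => hmS (hQ hm)
      unfold prodW
      rw [Finset.prod_insert hmS, if_neg hmQ, runI_succ_not_mem s n hmQ]
      ring
    have hop : ∀ Q ∈ (Finset.Ico (m + 1) (m + 1 + n)).powerset,
        prodW (insert m (Finset.Ico (m + 1) (m + 1 + n))) h (insert m Q) * (FSt.runI Amax C Cc (insert m Q) s m (n + 1)).pay Amax Kcred =
          h m * (prodW (Finset.Ico (m + 1) (m + 1 + n)) h Q * (FSt.runI Amax C Cc Q (s.op Amax Cc) (m + 1) n).pay Amax Kcred) := by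
      intro Q _
      unfold prodW
      rw [Finset.prod_insert hmS, if_pos (Finset.mem_insert_self m Q), runI_succ_mem s n (Finset.mem_insert_self m Q),
        runI_insert_of_lt Q n (m + 1) _ (Nat.lt_succ_self m)]
      have := prodW_insert_of_not_mem hmS h Q
      unfold prodW at this
      rw [this]
      ring
    rw [Finset.sum_congr rfl hcl, Finset.sum_congr rfl hop, ← Finset.mul_sum, ← Finset.mul_sum]
    ring

/-- **`autoE` is a pattern expectation**: `autoE start (h 0, …, h (K−1)) = Σ_{Q ⊆ range K} hairW K h Q · pay (run Q)`. [this work] -/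
theorem autoE_eq_sum_hairW (Amax C Cc Kcred : ℕ) (h : ℕ → ℝ) (K : ℕ) :
    autoE Amax C Cc Kcred FSt.start ((List.range K).map h) =
      ∑ Q ∈ (range K).powerset, hairW K h Q * (FSt.runI Amax C Cc Q FSt.start 0 K).pay Amax Kcred := by
  rw [List.range_eq_range', autoE_range', Nat.zero_add, Nat.Ico_zero_eq_range]
  rfl

/-! ## Invariants of the run and the comparison with the flank payoff -/

/-- Level of position `k`: the number of members of `Q` strictly below `k`. -/
def lvl (Q : Finset ℕ) (k : ℕ) : ℕ := (Q.filter fun e => e < k).card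

/-- The level is monotone in the position. [this work] -/
theorem lvl_mono (Q : Finset ℕ) {k t : ℕ} (hkt : k ≤ t) : lvl Q k ≤ lvl Q t :=
  Finset.card_le_card (Finset.monotone_filter_right Q fun e _ (he : e < k) => lt_of_lt_of_le he hkt)

/-- The level goes up by one across a member of `Q`. [this work] -/
theorem lvl_succ_of_mem {Q : Finset ℕ} {t : ℕ} (ht : t ∈ Q) : lvl Q (t + 1) = lvl Q t + 1 := by
  unfold lvl
  have : Q.filter (fun e => e < t + 1) = insert t (Q.filter fun e => e < t) := by
    ext e
    simp only [Finset.mem_filter, Finset.mem_insert]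
    constructor
    · rintro ⟨heQ, het⟩
      rcases Nat.lt_succ_iff_lt_or_eq.1 het with h | h
      · exact Or.inr ⟨heQ, h⟩
      · exact Or.inl h
    · rintro (rfl | ⟨heQ, het⟩)
      · exact ⟨ht, Nat.lt_succ_self e⟩
      · exact ⟨heQ, Nat.lt_succ_of_lt het⟩
  rw [this, Finset.card_insert_of_notMem (by simp)]

/-- The level is unchanged across a non-member of `Q`. [this work] -/
theorem lvl_succ_of_not_mem {Q : Finset ℕ} {t : ℕ} (ht : t ∉ Q) : lvl Q (t + 1) = lvl Q t := by
  unfold lvl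
  congr 1
  ext e
  simp only [Finset.mem_filter]
  constructor
  · rintro ⟨heQ, het⟩
    refine ⟨heQ, lt_of_le_of_ne (Nat.lt_succ_iff.1 het) ?_⟩
    rintro rfl
    exact ht heQ
  · rintro ⟨heQ, het⟩
    exact ⟨heQ, Nat.lt_succ_of_lt het⟩

/-- Past the support, the level is the cardinality of `Q`. [this work] -/
theorem lvl_eq_card_of_subset {Q : Finset ℕ} (hQ : Q ⊆ range K) : lvl Q K = Q.card := by
  unfold lvl
  congr 1
  exact Finset.filter_true_of_mem fun e he => Finset.mem_range.1 (hQ he)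

/-- One more position: the run over `m, …, m+n` ends with the step at `m+n`. -/
theorem runI_succ_right {Amax C Cc : ℕ} (Q : Finset ℕ) (s : FSt) (m n : ℕ) :
    FSt.runI Amax C Cc Q s m (n + 1) =
      (if m + n ∈ Q then (FSt.runI Amax C Cc Q s m n).op Amax Cc else (FSt.runI Amax C Cc Q s m n).cl C) := by
  unfold FSt.runI
  rw [List.range'_concat, List.foldl_append, List.foldl_cons, List.foldl_nil, Nat.one_mul]

/-- The invariant of the run after the first `t` positions. -/
structure RunInv (Amax C Cc : ℕ) (Q : Finset ℕ) (t : ℕ) (st : FSt) : Prop where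
  hA : st.A = min (lvl Q t) Amax
  hNc : st.Nc ≤ ((range t).filter fun k => k ∉ Q ∧ lvl Q k = lvl Q t).card
  hNp : st.Np ≤ ((range t).filter fun k => k ∉ Q ∧ lvl Q k + 1 = lvl Q t).card
  hCf : st.Cf ≤ ((range t).filter fun k => k ∉ Q ∧ 2 ≤ lvl Q k ∧ lvl Q k + 2 ≤ lvl Q t).card
  hV : st.Valid Amax C Cc

/-- The run invariant holds at the start state. [this work] -/
theorem runInv_zero (Amax C Cc : ℕ) (Q : Finset ℕ) : RunInv Amax C Cc Q 0 FSt.start where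
  hA := by simp [FSt.start, lvl]
  hNc := by simp [FSt.start]
  hNp := by simp [FSt.start]
  hCf := by simp [FSt.start]
  hV := ⟨Nat.zero_le _, Nat.zero_le _, Nat.zero_le _, Nat.zero_le _⟩

/-- The invariant is preserved by reading an open hair. -/
theorem runInv_op {Amax C Cc : ℕ} {Q : Finset ℕ} {t : ℕ} {st : FSt} (h : RunInv Amax C Cc Q t st) (ht : t ∈ Q) :
    RunInv Amax C Cc Q (t + 1) (st.op Amax Cc) := by
  have hl := lvl_succ_of_mem ht
  -- the closed sets over `range (t+1)` are those over `range t` (`t` is open)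
  have hset : ∀ P : ℕ → Prop, ∀ [DecidablePred P], ((range (t + 1)).filter fun k => k ∉ Q ∧ P k) = ((range t).filter fun k => k ∉ Q ∧ P k) := by
    intro P _
    rw [Finset.range_add_one, Finset.filter_insert, if_neg (fun hc => hc.1 ht)]
  refine ⟨?_, ?_, ?_, ?_, GameSpec.valid_op h.hV⟩
  · show min (st.A + 1) Amax = min (lvl Q (t + 1)) Amax
    rw [h.hA, hl]
    omega
  · exact Nat.zero_le _
  · show st.Nc ≤ _
    rw [hset, hl]
    simpa using h.hNc
  · show min (st.Cf + (if 3 ≤ st.A then st.Np else 0)) Cc ≤ _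
    rw [hset, hl]
    refine le_trans (min_le_left _ _) ?_
    by_cases h3 : 3 ≤ st.A
    · rw [if_pos h3]
      have hn3 : 3 ≤ lvl Q t := by have := h.hA; rw [this] at h3; exact le_trans h3 (min_le_left _ _)
      set S1 := (range t).filter fun k => k ∉ Q ∧ 2 ≤ lvl Q k ∧ lvl Q k + 2 ≤ lvl Q t with hS1
      set S2 := (range t).filter fun k => k ∉ Q ∧ lvl Q k + 1 = lvl Q t with hS2
      set S := (range t).filter fun k => k ∉ Q ∧ 2 ≤ lvl Q k ∧ lvl Q k + 2 ≤ lvl Q t + 1 with hS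
      have hdisj : Disjoint S1 S2 := by
        rw [Finset.disjoint_filter]
        intro k _ h1 h2
        omega
      have hsub : S1 ∪ S2 ⊆ S := by
        intro k hk
        rw [Finset.mem_union, Finset.mem_filter, Finset.mem_filter] at hk
        rw [Finset.mem_filter]
        rcases hk with ⟨hk, hkQ, h2, h3'⟩ | ⟨hk, hkQ, h3'⟩
        · exact ⟨hk, hkQ, h2, by omega⟩
        · exact ⟨hk, hkQ, by omega, by omega⟩
      calc st.Cf + st.Np ≤ S1.card + S2.card := add_le_add h.hCf h.hNp
        _ = (S1 ∪ S2).card := (Finset.card_union_of_disjoint hdisj).symm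
        _ ≤ S.card := Finset.card_le_card hsub
    · rw [if_neg h3, add_zero]
      exact le_trans h.hCf (Finset.card_le_card (Finset.monotone_filter_right _ fun k _ hk => ⟨hk.1, hk.2.1, by omega⟩))

/-- The invariant is preserved by reading a closed hair. -/
theorem runInv_cl {Amax C Cc : ℕ} {Q : Finset ℕ} {t : ℕ} {st : FSt} (h : RunInv Amax C Cc Q t st) (ht : t ∉ Q) :
    RunInv Amax C Cc Q (t + 1) (st.cl C) := by
  have hl := lvl_succ_of_not_mem ht
  have hset : ∀ P : ℕ → Prop, ∀ [DecidablePred P], ((range (t + 1)).filter fun k => k ∉ Q ∧ P k) =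
      (if P t then insert t ((range t).filter fun k => k ∉ Q ∧ P k) else ((range t).filter fun k => k ∉ Q ∧ P k)) := by
    intro P _
    rw [Finset.range_add_one, Finset.filter_insert]
    by_cases hP : P t
    · rw [if_pos ⟨ht, hP⟩, if_pos hP]
    · rw [if_neg (fun hc => hP hc.2), if_neg hP]
  have htn : t ∉ (range t) := Finset.notMem_range_self
  refine ⟨?_, ?_, ?_, ?_, GameSpec.valid_cl h.hV⟩
  · show st.A = _
    rw [hl]; exact h.hA
  · show min (st.Nc + 1) C ≤ _
    rw [hset, hl, if_pos rfl, Finset.card_insert_of_notMem (fun hm => htn (Finset.mem_filter.1 hm).1)]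
    exact le_trans (min_le_left _ _) (Nat.succ_le_succ h.hNc)
  · show st.Np ≤ _
    rw [hset, hl, if_neg (by omega)]
    exact h.hNp
  · show st.Cf ≤ _
    rw [hset, hl, if_neg (by omega)]
    exact h.hCf

/-- The invariant holds along the whole run from the start. -/
theorem runInv_runI (Amax C Cc : ℕ) (Q : Finset ℕ) : ∀ t : ℕ, RunInv Amax C Cc Q t (FSt.runI Amax C Cc Q FSt.start 0 t) := by
  intro t
  induction t with
  | zero => exact runInv_zero Amax C Cc Q
  | succ t ih =>
    rw [runI_succ_right, Nat.zero_add]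
    by_cases ht : t ∈ Q
    · rw [if_pos ht]; exact runInv_op ih ht
    · rw [if_neg ht]; exact runInv_cl ih ht

/-- At the end of the run the confirmed count is at most `Fl(Q)` (`Q ⊆ range K`). -/
theorem cf_run_le_flankCount {Amax C Cc : ℕ} {Q : Finset ℕ} (hQ : Q ⊆ range K) :
    (FSt.runI Amax C Cc Q FSt.start 0 K).Cf ≤ flankCount K Q := by
  refine le_trans (runInv_runI Amax C Cc Q K).hCf (le_of_eq ?_)
  unfold flankCount
  congr 1
  refine Finset.filter_congr fun k hk => ?_
  rw [lvl_eq_card_of_subset hQ]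
  refine and_congr_right fun hkQ => and_congr_right fun _ => ?_
  -- members above `k` = all members minus those below (none equals `k`)
  have hsplit := Finset.card_filter_add_card_filter_not (s := Q) (fun e => e < k)
  have hneg : (Q.filter fun e => ¬ e < k) = Q.filter fun e => k < e :=
    Finset.filter_congr fun e he => by
      constructor
      · intro hn; exact lt_of_le_of_ne (not_lt.1 hn) (fun hek => hkQ (hek ▸ he))
      · intro hlt; exact not_lt.2 hlt.le
  rw [hneg] at hsplit
  unfold lvl
  omega

/-- **The automaton's payoff on a pattern is at most the flank payoff** (`Q ⊆ range K`, `K ≤ Kcred`, `5 ≤ Amax`; caps only lose). [this work] -/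
theorem pay_run_le_flankPay {Amax C Cc Kcred : ℕ} (hA5 : 5 ≤ Amax) (hK : K ≤ Kcred) {Q : Finset ℕ} (hQ : Q ⊆ range K) :
    (FSt.runI Amax C Cc Q FSt.start 0 K).pay Amax Kcred ≤ flankPay K Q := by
  have hinv := runInv_runI Amax C Cc Q K
  have hAeq : (FSt.runI Amax C Cc Q FSt.start 0 K).A = min Q.card Amax := by rw [hinv.hA, lvl_eq_card_of_subset hQ]
  have hCf := cf_run_le_flankCount (Amax := Amax) (C := C) (Cc := Cc) hQ
  have hQK : Q.card ≤ K := le_trans (Finset.card_le_card hQ) (by simp)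
  set st := FSt.runI Amax C Cc Q FSt.start 0 K with hst
  unfold FSt.pay flankPay
  rw [hAeq]
  have hCfR : (st.Cf : ℝ) ≤ flankCount K Q := by exact_mod_cast hCf
  by_cases h4 : 4 ≤ Q.card
  · have hmin4 : 4 ≤ min Q.card Amax := le_min h4 (by omega)
    rw [if_pos hmin4, if_pos h4]
    have hden : (0 : ℝ) < (Q.card : ℝ) - 3 := by
      have : (4 : ℝ) ≤ Q.card := by exact_mod_cast h4
      linarith
    have hind : (if min Q.card Amax ≤ 4 then (1 : ℝ) else 0) = (if Q.card ≤ 4 then 1 else 0) := by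
      by_cases h5 : Q.card ≤ 4
      · rw [if_pos h5, if_pos (le_trans (min_le_left _ _) h5)]
      · rw [if_neg h5, if_neg (by rw [Nat.min_def]; split_ifs <;> omega)]
    rw [hind]
    gcongr ?_ - _
    by_cases hlt : min Q.card Amax < Amax
    · rw [if_pos hlt]
      have hmin : min Q.card Amax = Q.card := min_eq_left (by omega)
      rw [hmin]
      exact div_le_div_of_nonneg_right hCfR hden.le
    · rw [if_neg hlt]
      have hge : Amax ≤ Q.card := by rw [Nat.min_def] at hlt; split_ifs at hlt <;> omega
      have hden2 : (Q.card : ℝ) - 3 ≤ (Kcred : ℝ) - 3 := by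
        have : (Q.card : ℝ) ≤ Kcred := by exact_mod_cast hQK.trans hK
        linarith
      calc (st.Cf : ℝ) / ((Kcred : ℝ) - 3) ≤ (flankCount K Q : ℝ) / ((Kcred : ℝ) - 3) :=
            div_le_div_of_nonneg_right hCfR (hden.le.trans hden2)
        _ ≤ (flankCount K Q : ℝ) / ((Q.card : ℝ) - 3) :=
            div_le_div_of_nonneg_left (Nat.cast_nonneg _) hden hden2
  · have hmin : min Q.card Amax = Q.card := min_eq_left (by omega)
    rw [hmin, if_neg h4, if_neg h4]

/-! ## Certificate ⇒ nonnegative mean flank payoff at the certified words -/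

/-- **CERTIFICATE ⇒ `0 ≤ Σ_Q hairW · flankPay` AT EVERY CERTIFIED WORD.**  With `h k = k_{w_k}/q` the configuration of a word `w` of length `K ≥ 2`
(`K ≤ Kcred`, `5 ≤ Amax`) whose weight is listed in a passed certificate, `0 ≤ Σ_{Q ⊆ range K} hairW K h Q · flankPay K Q`. [this work] -/
theorem sum_hairW_flankPay_nonneg_of_gameCert {P : GameSpec} (W : P.WF) (hA5 : 5 ≤ P.Amax) {NB K : ℕ} (hKc : K ≤ P.Kcred)
    {Bs : List ℕ} (hc : P.gameCert NB K Bs = true) (hK : 2 ≤ K) (word : List ℕ) (hw : ∀ i ∈ word, i < P.nL)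
    (hlen : word.length = K) (hBs : (word.map P.wOf).sum ∈ Bs) (hNB : (word.map P.wOf).sum ≤ NB) :
    0 ≤ ∑ Q ∈ (range K).powerset, hairW K (fun k => P.gOf (word.getD k 0)) Q * flankPay K Q := by
  set h : ℕ → ℝ := fun k => P.gOf (word.getD k 0) with hh
  have hmap : word.map P.gOf = (List.range K).map h := by
    apply List.ext_getElem
    · simp [hlen]
    · intro n h1 h2
      simp only [List.getElem_map, List.getElem_range, hh]
      rw [List.getD_eq_getElem]
  have h0 := GameSpec.autoE_nonneg_of_gameCert W hc hK word hw hlen hBs hNB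
  rw [hmap, autoE_eq_sum_hairW] at h0
  refine le_trans h0 (Finset.sum_le_sum fun Q hQ => ?_)
  have hQ' : Q ⊆ range K := Finset.mem_powerset.1 hQ
  have h01 : ∀ k, k < K → 0 ≤ h k ∧ h k ≤ 1 := by
    intro k _
    simp only [hh, GameSpec.gOf]
    have hq : (0 : ℝ) < P.q := by exact_mod_cast W.q_pos
    refine ⟨div_nonneg (Nat.cast_nonneg _) hq.le, ?_⟩
    rw [div_le_one hq]
    by_cases hi : word.getD k 0 < P.nL
    · exact_mod_cast W.k_le _ hi
    · -- out-of-range letter index: numerator is the junk value 0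
      have : P.kOf (word.getD k 0) = 0 := by
        unfold GameSpec.kOf
        rw [List.getD_eq_default _ _ (by unfold GameSpec.nL at hi; omega)]
      rw [this]; exact_mod_cast hq.le
  exact mul_le_mul_of_nonneg_left (pay_run_le_flankPay hA5 hKc hQ') (hairW_nonneg h01 Q)

end Summit.CriticalPhenomena.PercolationContinuityZ3.Theorems.HairyCycle

end
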